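import Summits.HodgeConjecture.HodgeConjecture.Theorems.WeilTypeLadderLocalAnchor
import Summits.HodgeConjecture.HodgeConjecture.Theorems.WeilTypeLadderOnPath
import Summits.HodgeConjecture.HodgeConjecture.Theorems.PadicSemiregularLiftHodgeAbelianVarietiesStubDescendPrym
import HarnessLib

/-!
# WeilTypeLadder · DEGENERATION ONE DIMENSION UP: R2₈ ⟹ R1 ⟹ R1′ and R∞ ⟺ F0a ∧ R2

b2b cell `hweil` (packet `run/shared/lean/b2b/hodge-weil/`; notes `b2b-hweil-pv2-g3/VARIATIONAL-G3.md`). Prover 2,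
generation 3 (degeneration / variational). Markman's Cor. 1.6.1 / survey §11.5 Step 2 obtains Weil classes on abelian
FOURFOLDS of every discriminant from SPLIT SIXFOLDS by degenerating to products `X⁴ × S²` with a Weil-type SURFACE `S`
of complementary discriminant (the discriminant is multiplicative, every class in `ℚ^×/Nm(K^×)` is the discriminant of a
Weil surface — van Geemen LNM 1594 5.5) and descending along Schoen's transfer (Compositio 114 (1998) §10 Proposition).
Every sentence of that argument is stated in every even dimension, and the tree PROVES it in every dimension:
`stub_descend : 2 ≤ n → WeilAlgebraicSplitHyperplane (n+1) d → WeilAlgebraicAll n d` (crux `HodgeAbelianVarieties`,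
E-step `PrymCanonicalZ3SplitSeeds.Stubs.Descend`; partner half `exists_weilTypeSurface_prod_isHyperbolicWeilType_all_holds`,
transfer half `Schoen1998_weilClasses_algebraic_of_prod_surface_all_holds`, both THEOREMS). This file types the
consequences as EDGES OF THE B2b LADDER (`Theorems/WeilTypeLadder.lean`, `…OnPath.lean`), all UNCONDITIONAL
implications between open rungs:

* DEGENERATION ONE DIMENSION UP (Markman §11.5 Step 2 / Schoen 1998 §10 read at `n + 1`): the tree PROVES
  `stub_descend : 2 ≤ n → WeilAlgebraicSplitHyperplane (n+1) d → WeilAlgebraicAll n d` (split `2(n+1)`-folds ⟹ ALL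
  `2n`-folds: partner Weil SURFACE of complementary discriminant makes `A × S` split, Schoen's transfer descends; both
  halves discharged — `exists_weilTypeSurface_prod_isHyperbolicWeilType_all_holds`,
  `Schoen1998_weilClasses_algebraic_of_prod_surface_all_holds`; crux `HodgeAbelianVarieties`, E-step). Typed here
  as LADDER EDGES: `weilSixfolds_of_splitEightfolds : SplitEightfolds → WeilSixfolds` (**R2₈ ⟹ R1 = item
  stmt-HodgeConjecture-2524, ALL sixfolds, every discriminant**), `nonsplitSixfolds_of_splitEightfolds` (R2₈ ⟹ R1′),
  and `weilClassesImaginaryQuadratic_iff_floor_and_split : WeilClassesImaginaryQuadratic ↔ (F0a ∧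
  SplitWeilAbelianVarieties)` (**R∞ ⟺ F0a ∧ R2**: above the floor, Weil's question for every imaginary quadratic
  field, every dimension and EVERY discriminant is equivalent to its SPLIT case in dimensions `≥ 8`). Hence also
  `weilSixfolds_of_reach_of_localAnchor_four` / `nonsplitSixfolds_of_reach_of_localAnchor_four`: ONE locally
  algebraic anchor per `d` in dimension EIGHT gives all sixfolds, split or not.

So the ladder's DAG acquires R2₈ → R1 (hence R2₈ → R1′: the non-split sixfold rung sits BELOW the split eightfold
rung) and the exactness R∞ ↔ F0a ∧ R2; combined with `Theorems/WeilTypeLadderLocalAnchor.lean`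
(reach ∧ `∀ d, HasLocallyAlgebraicWeilAnchor 4 d` ⟹ R2₈), ONE locally algebraic hyperbolic anchor per `d` in dimension
8 would settle item stmt-HodgeConjecture-2524 (`WeilSixfolds`) — no non-split anchor is needed for the non-split
sixfolds. No definition; sorry-free; the only named-fact hypotheses are `weilFamilyReach_hyperbolic` and the floor's
statement where they appear explicitly. Serves stmt-HodgeConjecture-2524 without closing it.
-/

-- every declaration of this problem lives in `Summit.HodgeConjecture.HodgeConjecture.…` (summit = sub-problem)
set_option linter.dupNamespace false

noncomputable section

open CategoryTheory AlgebraicGeometry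

namespace Summit.HodgeConjecture.HodgeConjecture.WeilTypeLadder

open Literature.AlgebraicGeometry Literature.AlgebraicGeometry.Motives
open Literature.AlgebraicGeometry.HodgeTheory
open Literature.AlgebraicTopology.SingularHomology
/-! ## R2₈ ⟹ R1 (all sixfolds) ⟹ R1′, and R∞ ⟺ F0a ∧ R2 -/

open Summit.HodgeConjecture.HodgeConjecture.Cruxes.HodgeAbelianVarieties.EStepSecantInduction
open Summit.HodgeConjecture.HodgeConjecture.Cruxes.HodgeAbelianVarieties.PrymCanonicalZ3SplitSeeds.Stubs.Descend
  (stub_descend)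

/-- The ladder's split rungs feed the E-step predicate `WeilAlgebraicSplitHyperplane (n+1) d` of crux
`HodgeAbelianVarieties` (same statement up to binder order; the smooth-projectivity hypothesis of the rungs is
automatic for abelian varieties): from F0a at `n + 1 = 3` and from R2 (`SplitWeilAbelianVarieties`) at `n + 1 ≥ 4`.
[folklore] -/
theorem weilAlgebraicSplitHyperplane_succ_of_floor_of_split
    (hF0a : Markman2025_weilClasses_algebraic_hyperbolicSixfold) (h : SplitWeilAbelianVarieties)
    (n d : ℕ) (hn : 2 ≤ n) (hd : 0 < d) : Stubs.WeilAlgebraicSplitHyperplane (n + 1) d := by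
  intro B ψ e a hB hψ ha ha0 hhyp c hcW hc hH
  have hBsp : IsSmoothProjective (2 * (n + 1)) B.X := by
    have h' := AbelianVariety.isSmoothProjective_holds (A := B)
    rw [AbelianVariety.isSmoothProjective, hB] at h'
    exact h'
  rcases Nat.lt_or_ge n 3 with hlt | hge
  · obtain rfl : n = 2 := by omega
    exact hF0a d hd B ψ hB hBsp hψ e a ha ha0 hhyp c hc hH hcW
  · exact h (n + 1) (by omega) d hd B ψ hB hBsp hψ e a ha ha0 hhyp c hc hH hcW

/-- **R2₈ ⟹ R1: split EIGHTFOLDS give ALL SIXFOLDS (item stmt-HodgeConjecture-2524 `WeilSixfolds`, every `d`,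
every discriminant — split or not).** Degeneration of a split `ℚ(√-d)`-Weil eightfold to a product `A⁶ × S²`
(`S` a Weil-type surface of discriminant complementary to that of `A`, so that `A × S` is split — van Geemen 5.5,
Markman §11.5 Step 2 one dimension up) and Schoen's transfer `W(A × S) algebraic ⟹ W(A) algebraic` (Compositio
114 §10); both halves are THEOREMS of the tree, assembled as `stub_descend 3 d` (crux `HodgeAbelianVarieties`,
E-step). Unconditional implication; both sides open. [cite: Schoen1998HodgeWeilAddendum, §10 (Proposition)]
[cite: Markman2025SurveySecant, §11.5 Step 2] [cite: vanGeemen1994HodgeAV, 5.5] -/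
theorem weilSixfolds_of_splitEightfolds (h : SplitEightfolds) : Theses.SevenfoldWeilCensus.WeilSixfolds := by
  refine weilSixfolds_iff_weilClassesOf.2 ?_
  intro d hd A φ hA _ hφ c hc h33 hcW
  have h8 : Stubs.WeilAlgebraicSplitHyperplane (3 + 1) d := by
    intro B ψ e a hB hψ ha ha0 hhyp c' hc'W hc' hH
    have hBsp : IsSmoothProjective (2 * 4) B.X := by
      have h' := AbelianVariety.isSmoothProjective_holds (A := B)
      rw [AbelianVariety.isSmoothProjective, hB] at h'
      exact h'
    exact h d hd B ψ hB hBsp hψ e a ha ha0 hhyp c' hc' hH hc'W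
  exact stub_descend 3 d (by norm_num) hd h8 A φ hA hφ c hcW hc h33

/-- **R2₈ ⟹ R1′**: split eightfolds give in particular the NON-split sixfolds (`NonsplitSixfolds`, the cheapest
rung above the floor) — through R1 (`nonsplitSixfolds_of_weilSixfolds`). [cite: Schoen1998HodgeWeilAddendum, §10 (Proposition)]
[cite: Markman2025SurveySecant, §11.5 Step 2] -/
theorem nonsplitSixfolds_of_splitEightfolds (h : SplitEightfolds) : NonsplitSixfolds :=
  nonsplitSixfolds_of_weilSixfolds (weilSixfolds_of_splitEightfolds h)

/-- **R∞ ⟺ F0a ∧ R2: above the floor, Weil's question for imaginary quadratic fields (every `n ≥ 2`, every `d`,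
EVERY discriminant) is equivalent to its SPLIT case in dimensions `≥ 8`.** (⟸): for `(A, φ)` of dimension `2n`,
split `2(n+1)`-folds — F0a when `n = 2`, R2 when `n ≥ 3` — descend to all `2n`-folds by `stub_descend n d`
(partner surface + Schoen's transfer, both proved). (⟹): restriction (`splitWeilAbelianVarieties_of_…`, and R∞ at
`n = 3` on hyperbolic sixfolds). [cite: Schoen1998HodgeWeilAddendum, §10 (Proposition)]
[cite: Markman2025SurveySecant, §11.5 Steps 1–2] [cite: Markman2025SecantWeil, Thm. 1.5.1] -/
theorem weilClassesImaginaryQuadratic_iff_floor_and_split :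
    WeilClassesImaginaryQuadratic ↔
      (Markman2025_weilClasses_algebraic_hyperbolicSixfold ∧ SplitWeilAbelianVarieties) := by
  refine ⟨fun h => ⟨?_, splitWeilAbelianVarieties_of_weilClassesImaginaryQuadratic h⟩, fun ⟨hF0a, h⟩ => ?_⟩
  · intro d hd A φ hA hX hφ _ _ _ _ _ c hc h33 hcW
    exact h 3 (by norm_num) d hd A φ hA hX hφ c hc h33 hcW
  · intro n hn d hd A φ hA _ hφ c hc hnn hcW
    exact stub_descend n d hn hd (weilAlgebraicSplitHyperplane_succ_of_floor_of_split hF0a h n d hn hd)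
      A φ hA hφ c hcW hc hnn

/-- **ALL sixfolds (item stmt-2524) from Deligne's reach and ONE locally algebraic hyperbolic anchor per `d` in
dimension EIGHT** — `splitEightfolds_of_reach_of_localAnchor` then `weilSixfolds_of_splitEightfolds`. The non-split
sixfold rung thus needs no non-split anchor: a dimension-8 split anchor would do. [cite: Markman2025SecantWeil, §1.2]
[cite: Schoen1998HodgeWeilAddendum, §10 (Proposition)] [cite: Deligne1982HodgeCycles, proof of Thm. 4.8] -/
theorem weilSixfolds_of_reach_of_localAnchor_four (hF : weilFamilyReach_hyperbolic)
    (hL : ∀ d : ℕ, 0 < d → HasLocallyAlgebraicWeilAnchor 4 d) : Theses.SevenfoldWeilCensus.WeilSixfolds :=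
  weilSixfolds_of_splitEightfolds (splitEightfolds_of_reach_of_localAnchor hF hL)

/-- **R1′ from Deligne's reach and a locally algebraic hyperbolic anchor per `d` in dimension eight.**
[cite: Markman2025SecantWeil, §1.2] [cite: Schoen1998HodgeWeilAddendum, §10 (Proposition)] -/
theorem nonsplitSixfolds_of_reach_of_localAnchor_four (hF : weilFamilyReach_hyperbolic)
    (hL : ∀ d : ℕ, 0 < d → HasLocallyAlgebraicWeilAnchor 4 d) : NonsplitSixfolds :=
  nonsplitSixfolds_of_splitEightfolds (splitEightfolds_of_reach_of_localAnchor hF hL)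

end Summit.HodgeConjecture.HodgeConjecture.WeilTypeLadder

end
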